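import Summits.Ventures.QEC.Census.BB.A1s_n132_k8_73f8d92c
import Summits.Ventures.QEC.Census.BB.BBRows
import Summits.Ventures.QEC.Census.BB.Claims
import Literature.InformationTheory.QuantumCodes.TwoBlockConnectedComponents
import Literature.InformationTheory.QuantumCodes.TwoBlockToricLayout
import Literature.InformationTheory.QuantumCodes.TwoBlockWheelComponents
import Literature.InformationTheory.QuantumCodes.TwoBlockRootParameters
import HarnessLib
import HarnessLib.Audit.Tags

/-!
# Census rows as TYPED two-block codes `QC(A, B)` on `ℤ_ℓ × ℤ_m` — bridge batch `BridgeBatch6QC03` (1 row(s), kernel tier)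

Family: abelian two-block over ℤ_ℓ × ℤ_m (qec census one-module KERNEL-std rows: qec-search-7 certificate modules, MITM and
Brouwer–Zimmermann/automorphism formats). For each census row below (an EXPLICIT matrix code
`cert.code _ = CSSCode.ofMatrices (rowMatrix n cert.HX) (rowMatrix n cert.HZ)` with `IsCode n k d` certified in its own module), this file
puts the row's CONSTRUCTION into the kernel statement, as in the pilot `Census/BB/A1s_n144_k32_4addf704QC.lean` (p511732) and the
gen-4 batches `A1sRowsQC1–5` / `TwoBGARowsQC1–4`: monomial lists `la`, `lb` (from the certificate's construction record — the
docstring's `A_terms`/`B_terms` or the census row id `2bga-lℓmm-A…-B…`, monomials `xⁱyʲ` as `[i,j]`, convention of BCGMRY24 §4 =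
`BivariateBicycleCodes.lean`; the index identity was ALSO re-verified row-for-row by the emitter before filing), the typed object
`qc : BB.Code ℓ m := ⟨polyL la, polyL lb⟩`, the kernel INDEX IDENTITIES `cert.HX = BBRows.rowsX la lb`, `cert.HZ = BBRows.rowsZ la lb`
(`decide`; verified row generator `Census/BB/BBRows.lean`, p502918), the flat identities via `BBRows.rowMatrix_rowsX/Z`, the transport of
the row's own `dZ_eq` and `k` (its `k_eq`, or the `k`-component of its `isCode`) by type-05's `BB.Code.dZ_eq_of_flat` / `k_eq_of_flat` to
`qc_hasParams : BB.HasParams qc n k d` (census predicate of family BB, `Census/BB/Claims.lean`, distance EXACT) and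
`qc_isCode : qc.css.IsCode n k d`; and the census LAYOUT columns (Bravyi et al. 2024 §4 — arXiv:2308.07915: Lemma 2 p0010 L49, Lemma 3 p0011 L9, Lemma 4 p0011 L28; locators per qec-ref-2 2026-08-27T10:27Z) as KERNEL verdicts: «connected» —
`qc_tannerGraph_connected` (Lemma 3, `BB.Code.tannerGraph_connected_of_unit_mem`, explicit multiples of exponent differences) or
`qc_tannerGraph_not_connected` + `card_expDiffSubgroup` + `qc_card_connectedComponent` (`⟨S⟩` = an explicit finite carrier `diffList`,
both inclusions certified; exact component count by Lemma 3 (ii), `BB.Code.card_connectedComponent_mul_card`; by the tree's connected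
normal form `TwoBlockConnectedComponents.lean` such a code is the disjoint union of that many copies of its root code, whose parameters
`[[n/c, k/c, d]]` and connectedness are certified here as `root_isCode` via `TwoBlockRootParameters.lean`); «toric layout» —
`qc_hasToricLayoutWith μ λ` (Lemma 4, `BB.Code.hasToricLayoutWith_of_exponents`; omitted when its sufficient condition has no witness);
«wheel layers» — `qc_wheel_layers` (Lemma 2 minus planarity, `BB.Code.exists_wheel_layers`, weight-(3,3) rows only):

* `A1s_n132_k8_73f8d92c` = `QC(y^2 + x + x^2, y^18 + x + x^2)` on `ℤ_3 × ℤ_22`: `[[132, 8, 6]]`; Tanner graph NOT connected: |⟨S⟩| = 33, 2 components (= 2 × [[66, 4, 6]] — root code KERNEL `root_isCode`); wheel layers 6/66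

No new certificate — tier KERNEL, axioms standard, no `native_decide`. HONEST FRAMING: identifies already-certified census objects with
named algebraic constructions and decides structural (graph) properties; the census comparator columns (printed values, optimality
words) are not touched; for disconnected rows the root code is identified abstractly over `↥⟨S⟩` (not re-indexed to a named `QC(A',B')`,
not identified with a smaller census row); planarity/thickness is not asserted. Generated by
qec-type-05 gen 6's `tools/emit_qc_bridge3.py` (gen 5's emitter + sibling-data rows + ℓ = 1 connectivity) + `tools/conn_cert.py` (HOME/lean/type-05/tools/).
-/

namespace Summit.Ventures.QEC.Census.A1s_n132_k8_73f8d92c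

open Matrix Literature.InformationTheory.QuantumCodes BBRows

/-- Monomials of `A = y^2 + x + x^2` (construction `A_terms = [[0, 2], [1, 0], [2, 0]]`, from the census generator file `census/search-3/gens/a1/A1s_n132_k8_73f8d92c.json` (matrix_sha256 `73f8d92c58fed6aa…`; `A = y^2+x+x^2`, `B = y^18+x+x^2`)). DATA. -/
def la : List (BB.Mono 3 22) := [(Fin.ofNat 3 0, Fin.ofNat 22 2), (Fin.ofNat 3 1, Fin.ofNat 22 0), (Fin.ofNat 3 2, Fin.ofNat 22 0)]

/-- Monomials of `B = y^18 + x + x^2` (construction `B_terms = [[0, 18], [1, 0], [2, 0]]`). DATA. -/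
def lb : List (BB.Mono 3 22) := [(Fin.ofNat 3 0, Fin.ofNat 22 18), (Fin.ofNat 3 1, Fin.ofNat 22 0), (Fin.ofNat 3 2, Fin.ofNat 22 0)]

/-- The census row's code as a TYPED two-block code `QC(y^2 + x + x^2, y^18 + x + x^2)` on `ℤ_3 × ℤ_22` (`BB.Code 3 22`). (definition) -/
def qc : BB.Code 3 22 := ⟨polyL la, polyL lb⟩

set_option maxRecDepth 100000 in
/-- INDEX IDENTITY, `X` side, in the kernel: the certificate's `H^X` rows ARE the `X`-check words of `qc` (`decide +kernel`). -/
theorem HX_eq_rowsX : A1s_n132_k8_73f8d92c.cert.HX = rowsX la lb := by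
  decide +kernel

set_option maxRecDepth 100000 in
/-- INDEX IDENTITY, `Z` side. -/
theorem HZ_eq_rowsZ : A1s_n132_k8_73f8d92c.cert.HZ = rowsZ la lb := by
  decide +kernel

set_option maxRecDepth 100000 in
/-- The certificate's flat `H^X` is `qc.HXFlat`. -/
theorem rowMatrix_HX_eq : rowMatrix 132 A1s_n132_k8_73f8d92c.cert.HX = qc.HXFlat := by
  have cast : ∀ {H H' : List ℕ} (e : H = H'),
      rowMatrix 132 H = (rowMatrix 132 H').submatrix (Fin.cast (congrArg List.length e)) id := by
    intro H H' e; subst e; rfl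
  exact (cast HX_eq_rowsX).trans (rowMatrix_rowsX qc (LA := la) (LB := lb) rfl rfl)

set_option maxRecDepth 100000 in
/-- The certificate's flat `H^Z` is `qc.HZFlat`. -/
theorem rowMatrix_HZ_eq : rowMatrix 132 A1s_n132_k8_73f8d92c.cert.HZ = qc.HZFlat := by
  have cast : ∀ {H H' : List ℕ} (e : H = H'),
      rowMatrix 132 H = (rowMatrix 132 H').submatrix (Fin.cast (congrArg List.length e)) id := by
    intro H H' e; subst e; rfl
  exact (cast HZ_eq_rowsZ).trans (rowMatrix_rowsZ qc (LA := la) (LB := lb) rfl rfl)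

set_option maxRecDepth 100000 in
/-- `d^Z (qc) = 6`, transported from the census certificate (`A1s_n132_k8_73f8d92c.dZ_eq`) by `BB.Code.dZ_eq_of_flat`. -/
theorem qc_dZ : qc.css.dZ = 6 :=
  (qc.dZ_eq_of_flat (D := A1s_n132_k8_73f8d92c.cert.code (A1s_n132_k8_73f8d92c.cert.commOK_of_checkStructure A1s_n132_k8_73f8d92c.checkStructure_ok))
    rowMatrix_HX_eq rowMatrix_HZ_eq).symm.trans A1s_n132_k8_73f8d92c.dZ_eq

set_option maxRecDepth 100000 in
/-- `k (qc) = 8`, transported from the census certificate (`A1s_n132_k8_73f8d92c.k_eq`) by `BB.Code.k_eq_of_flat`. -/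
theorem qc_k : qc.k = 8 :=
  (qc.k_eq_of_flat (D := A1s_n132_k8_73f8d92c.cert.code (A1s_n132_k8_73f8d92c.cert.commOK_of_checkStructure A1s_n132_k8_73f8d92c.checkStructure_ok))
    rowMatrix_HX_eq rowMatrix_HZ_eq).symm.trans A1s_n132_k8_73f8d92c.k_eq

/-- **`QC(y^2 + x + x^2, y^18 + x + x^2)` on `ℤ_3 × ℤ_22` has parameters `[[132, 8, 6]]`** (distance exact; `BB.HasParams`) — the census row
`A1s_n132_k8_73f8d92c` read as a statement about the construction. KERNEL. -/
theorem qc_hasParams : Summit.Ventures.QEC.BB.HasParams qc 132 8 6 :=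
  BB.hasParams_of_dZ (by simp only [BB.numQubits_eq]) qc_k qc_dZ

/-- The same in the generic census vocabulary: `qc.css.IsCode 132 8 6`. -/
theorem qc_isCode : qc.css.IsCode 132 8 6 :=
  (BB.hasParams_iff_isCode (by decide)).1 qc_hasParams

/-! ### Connectivity: this row is DISCONNECTED (`|⟨S⟩| = 33` of `ℓm = 66` ⇒ `2` components by Lemma 3 (ii)) -/

/-- The exponent-difference subgroup `⟨S⟩` of `qc` as an explicit finite carrier (33 elements, closed under `0, +, −` —
computed by tools/conn_cert.py, closure re-checked by `decide` below). DATA. -/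
def diffList : List (BB.Mono 3 22) := [((0 : Fin 3), (0 : Fin 22)), ((0 : Fin 3), (2 : Fin 22)), ((0 : Fin 3), (4 : Fin 22)), ((0 : Fin 3), (6 : Fin 22)), ((0 : Fin 3), (8 : Fin 22)), ((0 : Fin 3), (10 : Fin 22)), ((0 : Fin 3), (12 : Fin 22)), ((0 : Fin 3), (14 : Fin 22)), ((0 : Fin 3), (16 : Fin 22)), ((0 : Fin 3), (18 : Fin 22)), ((0 : Fin 3), (20 : Fin 22)), ((1 : Fin 3), (0 : Fin 22)), ((1 : Fin 3), (2 : Fin 22)), ((1 : Fin 3), (4 : Fin 22)), ((1 : Fin 3), (6 : Fin 22)), ((1 : Fin 3), (8 : Fin 22)), ((1 : Fin 3), (10 : Fin 22)), ((1 : Fin 3), (12 : Fin 22)), ((1 : Fin 3), (14 : Fin 22)), ((1 : Fin 3), (16 : Fin 22)), ((1 : Fin 3), (18 : Fin 22)), ((1 : Fin 3), (20 : Fin 22)), ((2 : Fin 3), (0 : Fin 22)), ((2 : Fin 3), (2 : Fin 22)), ((2 : Fin 3), (4 : Fin 22)), ((2 : Fin 3), (6 : Fin 22)), ((2 : Fin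 3), (8 : Fin 22)), ((2 : Fin 3), (10 : Fin 22)), ((2 : Fin 3), (12 : Fin 22)), ((2 : Fin 3), (14 : Fin 22)), ((2 : Fin 3), (16 : Fin 22)), ((2 : Fin 3), (18 : Fin 22)), ((2 : Fin 3), (20 : Fin 22))]

set_option maxRecDepth 100000 in
/-- `diffList` contains `0`, is closed under addition and under negation (`decide`). -/
theorem diffList_closed : (((0 : Fin 3), (0 : Fin 22)) : BB.Mono 3 22) ∈ diffList ∧
    (∀ a b : BB.Mono 3 22, a ∈ diffList → b ∈ diffList → a + b ∈ diffList) ∧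
    (∀ a : BB.Mono 3 22, a ∈ diffList → -a ∈ diffList) := by
  refine ⟨by decide +kernel, by decide +kernel, by decide +kernel⟩

/-- `⟨S⟩` as an additive subgroup with carrier `diffList`. (definition) -/
def diffSub : AddSubgroup (BB.Mono 3 22) where
  carrier := {x | x ∈ diffList}
  zero_mem' := diffList_closed.1
  add_mem' := fun {a b} ha hb => diffList_closed.2.1 a b ha hb
  neg_mem' := fun {a} ha => diffList_closed.2.2 a ha

set_option maxRecDepth 100000 in
/-- Every exponent difference inside `A` and inside `B` lies in `diffList` (`decide` over all pairs of `ℤ_3 × ℤ_22`). -/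
theorem diffs_mem : (∀ g g' : BB.Mono 3 22, qc.A g ≠ 0 → qc.A g' ≠ 0 → g - g' ∈ diffList) ∧
    (∀ g g' : BB.Mono 3 22, qc.B g ≠ 0 → qc.B g' ≠ 0 → g - g' ∈ diffList) := by
  refine ⟨by decide +kernel, by decide +kernel⟩

/-- Hence `expDiffSubgroup qc ≤ diffSub`. -/
theorem expDiffSubgroup_le : qc.expDiffSubgroup ≤ diffSub :=
  (AddSubgroup.closure_le diffSub).2 (by
    rintro d (⟨g, g', hg, hg', rfl⟩ | ⟨g, g', hg, hg', rfl⟩)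
    · exact diffs_mem.1 g g' hg hg'
    · exact diffs_mem.2 g g' hg hg')

set_option maxRecDepth 100000 in
/-- **The Tanner graph of `qc` is NOT connected** (Bravyi et al. 2024 Lemma 3: `⟨S⟩ ≠ ℤ_3 × ℤ_22` — the element
`(0, 1)` is not an exponent-difference combination). Census column «connected» = false for this row, KERNEL. -/
theorem qc_tannerGraph_not_connected : ¬ qc.css.tannerGraph.Connected := fun h => by
  have htop := (qc.tannerGraph_connected_iff (fun h => absurd (congrFun h ((0 : Fin 3), (2 : Fin 22))) (by decide))
    (fun h => absurd (congrFun h ((0 : Fin 3), (18 : Fin 22))) (by decide))).1 h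
  have hx : (((0 : Fin 3), (1 : Fin 22)) : BB.Mono 3 22) ∈ diffSub := expDiffSubgroup_le (htop ▸ AddSubgroup.mem_top _)
  have hx' : (((0 : Fin 3), (1 : Fin 22)) : BB.Mono 3 22) ∈ diffList := hx
  exact absurd hx' (by decide)

set_option maxRecDepth 100000 in
/-- Conversely every element of `diffList` IS an exponent-difference combination (BFS certificate from `0`: each element = an
earlier one + one difference inside `A` or `B`; tools/conn_cert.py), so `⟨S⟩ = diffSub` exactly. -/
theorem diffList_le : ∀ x : BB.Mono 3 22, x ∈ diffList → x ∈ qc.expDiffSubgroup := by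
  have m0 : (((0 : Fin 3), (0 : Fin 22)) : BB.Mono 3 22) ∈ qc.expDiffSubgroup := qc.expDiffSubgroup.zero_mem
  have m1 : (((2 : Fin 3), (2 : Fin 22)) : BB.Mono 3 22) ∈ qc.expDiffSubgroup := by
    have e : (((2 : Fin 3), (2 : Fin 22)) : BB.Mono 3 22) =
        ((0 : Fin 3), (0 : Fin 22)) + ((((0 : Fin 3), (2 : Fin 22))) - (1, 0)) := by decide
    rw [e]
    exact qc.expDiffSubgroup.add_mem m0 (qc.sub_mem_expDiffSubgroup_A (by decide) (by decide))
  have m2 : (((1 : Fin 3), (2 : Fin 22)) : BB.Mono 3 22) ∈ qc.expDiffSubgroup := by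
    have e : (((1 : Fin 3), (2 : Fin 22)) : BB.Mono 3 22) =
        ((0 : Fin 3), (0 : Fin 22)) + ((((0 : Fin 3), (2 : Fin 22))) - (2, 0)) := by decide
    rw [e]
    exact qc.expDiffSubgroup.add_mem m0 (qc.sub_mem_expDiffSubgroup_A (by decide) (by decide))
  have m3 : (((1 : Fin 3), (20 : Fin 22)) : BB.Mono 3 22) ∈ qc.expDiffSubgroup := by
    have e : (((1 : Fin 3), (20 : Fin 22)) : BB.Mono 3 22) =
        ((0 : Fin 3), (0 : Fin 22)) + ((((1 : Fin 3), (0 : Fin 22))) - (0, 2)) := by decide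
    rw [e]
    exact qc.expDiffSubgroup.add_mem m0 (qc.sub_mem_expDiffSubgroup_A (by decide) (by decide))
  have m4 : (((2 : Fin 3), (0 : Fin 22)) : BB.Mono 3 22) ∈ qc.expDiffSubgroup := by
    have e : (((2 : Fin 3), (0 : Fin 22)) : BB.Mono 3 22) =
        ((0 : Fin 3), (0 : Fin 22)) + ((((1 : Fin 3), (0 : Fin 22))) - (2, 0)) := by decide
    rw [e]
    exact qc.expDiffSubgroup.add_mem m0 (qc.sub_mem_expDiffSubgroup_A (by decide) (by decide))
  have m5 : (((2 : Fin 3), (20 : Fin 22)) : BB.Mono 3 22) ∈ qc.expDiffSubgroup := by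
    have e : (((2 : Fin 3), (20 : Fin 22)) : BB.Mono 3 22) =
        ((0 : Fin 3), (0 : Fin 22)) + ((((2 : Fin 3), (0 : Fin 22))) - (0, 2)) := by decide
    rw [e]
    exact qc.expDiffSubgroup.add_mem m0 (qc.sub_mem_expDiffSubgroup_A (by decide) (by decide))
  have m6 : (((1 : Fin 3), (0 : Fin 22)) : BB.Mono 3 22) ∈ qc.expDiffSubgroup := by
    have e : (((1 : Fin 3), (0 : Fin 22)) : BB.Mono 3 22) =
        ((0 : Fin 3), (0 : Fin 22)) + ((((2 : Fin 3), (0 : Fin 22))) - (1, 0)) := by decide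
    rw [e]
    exact qc.expDiffSubgroup.add_mem m0 (qc.sub_mem_expDiffSubgroup_A (by decide) (by decide))
  have m7 : (((2 : Fin 3), (18 : Fin 22)) : BB.Mono 3 22) ∈ qc.expDiffSubgroup := by
    have e : (((2 : Fin 3), (18 : Fin 22)) : BB.Mono 3 22) =
        ((0 : Fin 3), (0 : Fin 22)) + ((((0 : Fin 3), (18 : Fin 22))) - (1, 0)) := by decide
    rw [e]
    exact qc.expDiffSubgroup.add_mem m0 (qc.sub_mem_expDiffSubgroup_B (by decide) (by decide))
  have m8 : (((1 : Fin 3), (18 : Fin 22)) : BB.Mono 3 22) ∈ qc.expDiffSubgroup := by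
    have e : (((1 : Fin 3), (18 : Fin 22)) : BB.Mono 3 22) =
        ((0 : Fin 3), (0 : Fin 22)) + ((((0 : Fin 3), (18 : Fin 22))) - (2, 0)) := by decide
    rw [e]
    exact qc.expDiffSubgroup.add_mem m0 (qc.sub_mem_expDiffSubgroup_B (by decide) (by decide))
  have m9 : (((1 : Fin 3), (4 : Fin 22)) : BB.Mono 3 22) ∈ qc.expDiffSubgroup := by
    have e : (((1 : Fin 3), (4 : Fin 22)) : BB.Mono 3 22) =
        ((0 : Fin 3), (0 : Fin 22)) + ((((1 : Fin 3), (0 : Fin 22))) - (0, 18)) := by decide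
    rw [e]
    exact qc.expDiffSubgroup.add_mem m0 (qc.sub_mem_expDiffSubgroup_B (by decide) (by decide))
  have m10 : (((2 : Fin 3), (4 : Fin 22)) : BB.Mono 3 22) ∈ qc.expDiffSubgroup := by
    have e : (((2 : Fin 3), (4 : Fin 22)) : BB.Mono 3 22) =
        ((0 : Fin 3), (0 : Fin 22)) + ((((2 : Fin 3), (0 : Fin 22))) - (0, 18)) := by decide
    rw [e]
    exact qc.expDiffSubgroup.add_mem m0 (qc.sub_mem_expDiffSubgroup_B (by decide) (by decide))
  have m11 : (((0 : Fin 3), (4 : Fin 22)) : BB.Mono 3 22) ∈ qc.expDiffSubgroup := by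
    have e : (((0 : Fin 3), (4 : Fin 22)) : BB.Mono 3 22) =
        ((2 : Fin 3), (2 : Fin 22)) + ((((0 : Fin 3), (2 : Fin 22))) - (2, 0)) := by decide
    rw [e]
    exact qc.expDiffSubgroup.add_mem m1 (qc.sub_mem_expDiffSubgroup_A (by decide) (by decide))
  have m12 : (((0 : Fin 3), (2 : Fin 22)) : BB.Mono 3 22) ∈ qc.expDiffSubgroup := by
    have e : (((0 : Fin 3), (2 : Fin 22)) : BB.Mono 3 22) =
        ((2 : Fin 3), (2 : Fin 22)) + ((((2 : Fin 3), (0 : Fin 22))) - (1, 0)) := by decide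
    rw [e]
    exact qc.expDiffSubgroup.add_mem m1 (qc.sub_mem_expDiffSubgroup_A (by decide) (by decide))
  have m13 : (((0 : Fin 3), (20 : Fin 22)) : BB.Mono 3 22) ∈ qc.expDiffSubgroup := by
    have e : (((0 : Fin 3), (20 : Fin 22)) : BB.Mono 3 22) =
        ((2 : Fin 3), (2 : Fin 22)) + ((((0 : Fin 3), (18 : Fin 22))) - (2, 0)) := by decide
    rw [e]
    exact qc.expDiffSubgroup.add_mem m1 (qc.sub_mem_expDiffSubgroup_B (by decide) (by decide))
  have m14 : (((0 : Fin 3), (6 : Fin 22)) : BB.Mono 3 22) ∈ qc.expDiffSubgroup := by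
    have e : (((0 : Fin 3), (6 : Fin 22)) : BB.Mono 3 22) =
        ((2 : Fin 3), (2 : Fin 22)) + ((((1 : Fin 3), (0 : Fin 22))) - (0, 18)) := by decide
    rw [e]
    exact qc.expDiffSubgroup.add_mem m1 (qc.sub_mem_expDiffSubgroup_B (by decide) (by decide))
  have m15 : (((1 : Fin 3), (6 : Fin 22)) : BB.Mono 3 22) ∈ qc.expDiffSubgroup := by
    have e : (((1 : Fin 3), (6 : Fin 22)) : BB.Mono 3 22) =
        ((2 : Fin 3), (2 : Fin 22)) + ((((2 : Fin 3), (0 : Fin 22))) - (0, 18)) := by decide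
    rw [e]
    exact qc.expDiffSubgroup.add_mem m1 (qc.sub_mem_expDiffSubgroup_B (by decide) (by decide))
  have m16 : (((2 : Fin 3), (6 : Fin 22)) : BB.Mono 3 22) ∈ qc.expDiffSubgroup := by
    have e : (((2 : Fin 3), (6 : Fin 22)) : BB.Mono 3 22) =
        ((1 : Fin 3), (2 : Fin 22)) + ((((1 : Fin 3), (0 : Fin 22))) - (0, 18)) := by decide
    rw [e]
    exact qc.expDiffSubgroup.add_mem m2 (qc.sub_mem_expDiffSubgroup_B (by decide) (by decide))
  have m17 : (((0 : Fin 3), (18 : Fin 22)) : BB.Mono 3 22) ∈ qc.expDiffSubgroup := by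
    have e : (((0 : Fin 3), (18 : Fin 22)) : BB.Mono 3 22) =
        ((1 : Fin 3), (20 : Fin 22)) + ((((2 : Fin 3), (0 : Fin 22))) - (0, 2)) := by decide
    rw [e]
    exact qc.expDiffSubgroup.add_mem m3 (qc.sub_mem_expDiffSubgroup_A (by decide) (by decide))
  have m18 : (((0 : Fin 3), (16 : Fin 22)) : BB.Mono 3 22) ∈ qc.expDiffSubgroup := by
    have e : (((0 : Fin 3), (16 : Fin 22)) : BB.Mono 3 22) =
        ((1 : Fin 3), (20 : Fin 22)) + ((((0 : Fin 3), (18 : Fin 22))) - (1, 0)) := by decide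
    rw [e]
    exact qc.expDiffSubgroup.add_mem m3 (qc.sub_mem_expDiffSubgroup_B (by decide) (by decide))
  have m19 : (((2 : Fin 3), (16 : Fin 22)) : BB.Mono 3 22) ∈ qc.expDiffSubgroup := by
    have e : (((2 : Fin 3), (16 : Fin 22)) : BB.Mono 3 22) =
        ((1 : Fin 3), (20 : Fin 22)) + ((((0 : Fin 3), (18 : Fin 22))) - (2, 0)) := by decide
    rw [e]
    exact qc.expDiffSubgroup.add_mem m3 (qc.sub_mem_expDiffSubgroup_B (by decide) (by decide))
  have m20 : (((1 : Fin 3), (16 : Fin 22)) : BB.Mono 3 22) ∈ qc.expDiffSubgroup := by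
    have e : (((1 : Fin 3), (16 : Fin 22)) : BB.Mono 3 22) =
        ((2 : Fin 3), (20 : Fin 22)) + ((((0 : Fin 3), (18 : Fin 22))) - (1, 0)) := by decide
    rw [e]
    exact qc.expDiffSubgroup.add_mem m5 (qc.sub_mem_expDiffSubgroup_B (by decide) (by decide))
  have m21 : (((1 : Fin 3), (14 : Fin 22)) : BB.Mono 3 22) ∈ qc.expDiffSubgroup := by
    have e : (((1 : Fin 3), (14 : Fin 22)) : BB.Mono 3 22) =
        ((2 : Fin 3), (18 : Fin 22)) + ((((0 : Fin 3), (18 : Fin 22))) - (1, 0)) := by decide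
    rw [e]
    exact qc.expDiffSubgroup.add_mem m7 (qc.sub_mem_expDiffSubgroup_B (by decide) (by decide))
  have m22 : (((0 : Fin 3), (14 : Fin 22)) : BB.Mono 3 22) ∈ qc.expDiffSubgroup := by
    have e : (((0 : Fin 3), (14 : Fin 22)) : BB.Mono 3 22) =
        ((2 : Fin 3), (18 : Fin 22)) + ((((0 : Fin 3), (18 : Fin 22))) - (2, 0)) := by decide
    rw [e]
    exact qc.expDiffSubgroup.add_mem m7 (qc.sub_mem_expDiffSubgroup_B (by decide) (by decide))
  have m23 : (((2 : Fin 3), (14 : Fin 22)) : BB.Mono 3 22) ∈ qc.expDiffSubgroup := by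
    have e : (((2 : Fin 3), (14 : Fin 22)) : BB.Mono 3 22) =
        ((1 : Fin 3), (18 : Fin 22)) + ((((0 : Fin 3), (18 : Fin 22))) - (2, 0)) := by decide
    rw [e]
    exact qc.expDiffSubgroup.add_mem m8 (qc.sub_mem_expDiffSubgroup_B (by decide) (by decide))
  have m24 : (((2 : Fin 3), (8 : Fin 22)) : BB.Mono 3 22) ∈ qc.expDiffSubgroup := by
    have e : (((2 : Fin 3), (8 : Fin 22)) : BB.Mono 3 22) =
        ((1 : Fin 3), (4 : Fin 22)) + ((((1 : Fin 3), (0 : Fin 22))) - (0, 18)) := by decide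
    rw [e]
    exact qc.expDiffSubgroup.add_mem m9 (qc.sub_mem_expDiffSubgroup_B (by decide) (by decide))
  have m25 : (((0 : Fin 3), (8 : Fin 22)) : BB.Mono 3 22) ∈ qc.expDiffSubgroup := by
    have e : (((0 : Fin 3), (8 : Fin 22)) : BB.Mono 3 22) =
        ((1 : Fin 3), (4 : Fin 22)) + ((((2 : Fin 3), (0 : Fin 22))) - (0, 18)) := by decide
    rw [e]
    exact qc.expDiffSubgroup.add_mem m9 (qc.sub_mem_expDiffSubgroup_B (by decide) (by decide))
  have m26 : (((1 : Fin 3), (8 : Fin 22)) : BB.Mono 3 22) ∈ qc.expDiffSubgroup := by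
    have e : (((1 : Fin 3), (8 : Fin 22)) : BB.Mono 3 22) =
        ((2 : Fin 3), (4 : Fin 22)) + ((((2 : Fin 3), (0 : Fin 22))) - (0, 18)) := by decide
    rw [e]
    exact qc.expDiffSubgroup.add_mem m10 (qc.sub_mem_expDiffSubgroup_B (by decide) (by decide))
  have m27 : (((1 : Fin 3), (10 : Fin 22)) : BB.Mono 3 22) ∈ qc.expDiffSubgroup := by
    have e : (((1 : Fin 3), (10 : Fin 22)) : BB.Mono 3 22) =
        ((0 : Fin 3), (6 : Fin 22)) + ((((1 : Fin 3), (0 : Fin 22))) - (0, 18)) := by decide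
    rw [e]
    exact qc.expDiffSubgroup.add_mem m14 (qc.sub_mem_expDiffSubgroup_B (by decide) (by decide))
  have m28 : (((2 : Fin 3), (10 : Fin 22)) : BB.Mono 3 22) ∈ qc.expDiffSubgroup := by
    have e : (((2 : Fin 3), (10 : Fin 22)) : BB.Mono 3 22) =
        ((0 : Fin 3), (6 : Fin 22)) + ((((2 : Fin 3), (0 : Fin 22))) - (0, 18)) := by decide
    rw [e]
    exact qc.expDiffSubgroup.add_mem m14 (qc.sub_mem_expDiffSubgroup_B (by decide) (by decide))
  have m29 : (((0 : Fin 3), (10 : Fin 22)) : BB.Mono 3 22) ∈ qc.expDiffSubgroup := by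
    have e : (((0 : Fin 3), (10 : Fin 22)) : BB.Mono 3 22) =
        ((1 : Fin 3), (6 : Fin 22)) + ((((2 : Fin 3), (0 : Fin 22))) - (0, 18)) := by decide
    rw [e]
    exact qc.expDiffSubgroup.add_mem m15 (qc.sub_mem_expDiffSubgroup_B (by decide) (by decide))
  have m30 : (((2 : Fin 3), (12 : Fin 22)) : BB.Mono 3 22) ∈ qc.expDiffSubgroup := by
    have e : (((2 : Fin 3), (12 : Fin 22)) : BB.Mono 3 22) =
        ((0 : Fin 3), (16 : Fin 22)) + ((((0 : Fin 3), (18 : Fin 22))) - (1, 0)) := by decide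
    rw [e]
    exact qc.expDiffSubgroup.add_mem m18 (qc.sub_mem_expDiffSubgroup_B (by decide) (by decide))
  have m31 : (((1 : Fin 3), (12 : Fin 22)) : BB.Mono 3 22) ∈ qc.expDiffSubgroup := by
    have e : (((1 : Fin 3), (12 : Fin 22)) : BB.Mono 3 22) =
        ((0 : Fin 3), (16 : Fin 22)) + ((((0 : Fin 3), (18 : Fin 22))) - (2, 0)) := by decide
    rw [e]
    exact qc.expDiffSubgroup.add_mem m18 (qc.sub_mem_expDiffSubgroup_B (by decide) (by decide))
  have m32 : (((0 : Fin 3), (12 : Fin 22)) : BB.Mono 3 22) ∈ qc.expDiffSubgroup := by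
    have e : (((0 : Fin 3), (12 : Fin 22)) : BB.Mono 3 22) =
        ((2 : Fin 3), (16 : Fin 22)) + ((((0 : Fin 3), (18 : Fin 22))) - (2, 0)) := by decide
    rw [e]
    exact qc.expDiffSubgroup.add_mem m19 (qc.sub_mem_expDiffSubgroup_B (by decide) (by decide))
  simp only [diffList, List.forall_mem_cons]
  exact ⟨m0, m12, m11, m14, m25, m29, m32, m22, m18, m17, m13, m6, m2, m9, m15, m26, m27, m31, m21, m20, m8, m3, m4, m1, m10, m16, m24, m28, m30, m23, m19, m7, m5, by simp⟩

/-- `⟨S⟩ = diffSub` (`33` elements). -/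
theorem expDiffSubgroup_eq : qc.expDiffSubgroup = diffSub :=
  le_antisymm expDiffSubgroup_le (fun x hx => diffList_le x hx)

set_option maxRecDepth 100000 in
/-- `|⟨S⟩| = 33`. -/
theorem card_expDiffSubgroup : Nat.card qc.expDiffSubgroup = 33 := by
  rw [expDiffSubgroup_eq]
  change Nat.card {x : BB.Mono 3 22 // x ∈ diffList} = 33
  rw [Nat.card_eq_fintype_card]
  decide +kernel

set_option maxRecDepth 100000 in
/-- **The Tanner graph of `qc` has exactly `2` connected components** (BCGMRY24 Lemma 3 (ii): `#components · |⟨S⟩| = ℓm`,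
`66 / 33 = 2`); with the tree's connected normal form (`TwoBlockConnectedComponents.lean`) the code is the disjoint union of
`2` copies of the root two-block code over `⟨S⟩` — numerically `2 × [[66, 4, 6]]`. KERNEL. -/
theorem qc_card_connectedComponent : Nat.card qc.css.tannerGraph.ConnectedComponent = 2 := by
  have h := qc.card_connectedComponent_mul_card
    (fun h => absurd (congrFun h ((0 : Fin 3), (2 : Fin 22))) (by decide))
    (fun h => absurd (congrFun h ((0 : Fin 3), (18 : Fin 22))) (by decide))
  rw [card_expDiffSubgroup] at h
  omega

open scoped Classical in
/-- **`= 2 ×` a CONNECTED root code `[[66, 4, 6]]`, KERNEL** (not only numerically): the typed root two-block code of `qc`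
over `⟨S⟩` (`BB.Code.rootCode`, `Literature/InformationTheory/QuantumCodes/TwoBlockRootParameters.lean`, base exponents the first monomials
of `A` and `B`) is a `[[66, 4, 6]]` code with a connected Tanner graph, and `2 ∣ 132`, `2 ∣ 8` (`BB.Code.rootCode_isCode` on
`qc_isCode` and `qc_card_connectedComponent`). The root is NOT re-indexed to a named `QC(A', B')` here. -/
theorem root_isCode :
    (qc.rootCode (((0 : Fin 3), (2 : Fin 22)) : BB.Mono 3 22) ((0 : Fin 3), (18 : Fin 22))).IsCode 66 4 6 ∧
    (qc.rootCode (((0 : Fin 3), (2 : Fin 22)) : BB.Mono 3 22) ((0 : Fin 3), (18 : Fin 22))).tannerGraph.Connected ∧ 2 ∣ 132 ∧ 2 ∣ 8 :=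
  qc.rootCode_isCode (by decide) (by decide) qc_isCode qc_card_connectedComponent

set_option maxRecDepth 100000 in
/-- **`qc`**: Tanner graph = edge-disjoint union of two layers whose components are wheel graphs `prismGraph 6` (`A₃A₂ᵀ` of order
`3`) and `prismGraph 66` (`B₂B₁ᵀ` of order `33`) — BCGMRY24 Lemma 2 minus planarity (`BB.Code.exists_wheel_layers`). KERNEL. -/
theorem qc_wheel_layers :
    ∃ ΓA ΓB : SimpleGraph ((BB.Mono 3 22 ⊕ BB.Mono 3 22) ⊕ (BB.Mono 3 22 ⊕ BB.Mono 3 22)),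
    qc.css.tannerGraph = ΓA ⊔ ΓB ∧ Disjoint ΓA ΓB ∧
    (∀ K : ΓA.ConnectedComponent, Nonempty (K.toSimpleGraph ≃g prismGraph 6)) ∧
    (∀ K : ΓB.ConnectedComponent, Nonempty (K.toSimpleGraph ≃g prismGraph 66)) := by
  have hA : ∀ g : BB.Mono 3 22, qc.A g ≠ 0 ↔ g = ((0 : Fin 3), (2 : Fin 22)) ∨ g = ((1 : Fin 3), (0 : Fin 22)) ∨ g = ((2 : Fin 3), (0 : Fin 22)) := by decide +kernel
  have hB : ∀ g : BB.Mono 3 22, qc.B g ≠ 0 ↔ g = ((0 : Fin 3), (18 : Fin 22)) ∨ g = ((1 : Fin 3), (0 : Fin 22)) ∨ g = ((2 : Fin 3), (0 : Fin 22)) := by decide +kernel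
  have h := qc.exists_wheel_layers (g₁ := ((0 : Fin 3), (2 : Fin 22))) (g₂ := ((1 : Fin 3), (0 : Fin 22))) (g₃ := ((2 : Fin 3), (0 : Fin 22))) (h₁ := ((0 : Fin 3), (18 : Fin 22)))
    (h₂ := ((1 : Fin 3), (0 : Fin 22))) (h₃ := ((2 : Fin 3), (0 : Fin 22))) (by decide) (by decide) (by decide) (by decide) (by decide) (by decide) hA hB
  have e1 : addOrderOf (((2 : Fin 3), (0 : Fin 22)) - (1, 0)) = 3 := (addOrderOf_eq_iff (by norm_num)).mpr (by decide)
  have e2 : addOrderOf (((1 : Fin 3), (0 : Fin 22)) - (0, 18)) = 33 := (addOrderOf_eq_iff (by norm_num)).mpr (by decide)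
  rw [e1, e2] at h
  exact h

end Summit.Ventures.QEC.Census.A1s_n132_k8_73f8d92c
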